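/-
Copyright: the b2b-balaban cell (near-miss cell 7), T⁴-continuum fan-out, lineage t4-ne7b-p1 (node U5c COUNT member).
Released under the licence of the surrounding project.
-/
import Summits.QuantumFields.BalabanUV.T4Continuum.Support.ZoneTorus

/-!
# Zone diameter: the cyclic sup-diameter of a zone on the torus — triangle inequality, overlap, blocking contraction

Summits-side support leaf of the T⁴-continuum cell (rung (B)+1 on a FINITE torus only; NOT infinite volume, NOT the
mass gap, NOT the Clay statement; NOT a proof of the spine estimate NE7b).  Lineage `t4-ne7b-p1` (generation 20),
node U5c, wall (GM), located item G-ne7bp1g18-2.  [folklore] finite geometry of `(ℤ∕m)^d`; nothing is quoted from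
print and nothing printed is asserted; no `[cite:]` tag.

WHY.  `Support/ZoneExtentLaw.lean` reduces the affine contraction law of the zone chain to four dynamical inequalities
(`ZoneDyn`) on an extent function, and `Support/ZoneTorus.lean` fixes the nearness `nearT` (cyclic sup-distance of
level-`t` blocks).  The natural extent of a zone — a finite set of level-`t` block vectors on the torus
`(ℤ∕m)^d`, `m = n·L^{K−t}` — is its CYCLIC SUP-DIAMETER `diam m S`.  This leaf proves the three (ID)-free geometric facts
that make `diam` fit BOTH shapes at once, with the constants EXACTLY as landed (`+1` per blocking step, radius
`ext X + ext Y`):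
* (N∕M) OVERLAP: if two zones share a block then any two of their points are within `diam A + diam B`
  (`cdist_le_diam_add_of_overlap` — the `AdmZ` radius, no gap term) and `diam (A ∪ B) ≤ diam A + diam B`
  (`diam_union_le_of_overlap` — `ZoneDyn.merge` with room to spare);
* (S) BLOCKING CONTRACTS: blocking `u ↦ ⌊u∕L⌋` from `(ℤ∕mL)^d` to `(ℤ∕m)^d` gives
  `diam m (blocks S) ≤ diam (mL) S ∕ L + 1` (`diam_blocks_le`, natural division; real form `diam_blocks_le_real` —
  `ZoneDyn.step` with `σ² = 1∕L`).
The metric facts underneath: `cycd_triangle` (the cyclic distance is a metric on `[0,m)`), `cycd_div_le`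
(`cycd m ⌊a∕L⌋ ⌊b∕L⌋ ≤ cycd (mL) a b ∕ L + 1`).  §4 `nearT_of_mem_overlap`: on the cutoff-`K` torus, two scale cells
whose level-`t` blocks lie in overlapping zones `A`, `B` are `nearT … t (diam A + diam B)`.

WHAT THIS LEAVES TO THE READING (ID) (G-ne7bp1g9-1): which level-`t` blocks a structure's zone occupies (so that the
root's block lies in it, merger partners' zones OVERLAP, the merged zone is the union, the zone one step later is the
blocked zone, a renewal adds nothing, a birth of class `d′` spans `≤ Cb·(d′+1)` blocks).  (E2)∕(R1) untouched.

HONEST DEPENDENCY (cell): continuum YM on T⁴ ⇐ BetaPertH ∧ nine spine estimates (0/9 proved); BetaPertH ⇐ (D1) ∧ (D4)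
∧ CAP+tail.  This file changes none of it.
-/

open Finset

namespace Summit.QuantumFields.BalabanUV.T4Continuum.ZoneTorus

/-! ## §1 The cyclic distance is a metric; blocking contracts it -/

/-- `cycd m a a = 0` [folklore] -/
@[simp] theorem cycd_self (m a : ℕ) : cycd m a a = 0 := by simp [cycd]

/-- **TRIANGLE INEQUALITY** for the cyclic distance on `[0,m)`. [folklore] -/
theorem cycd_triangle {m a b c : ℕ} (ha : a < m) (hb : b < m) (hc : c < m) :
    cycd m a c ≤ cycd m a b + cycd m b c := by
  simp only [cycd, Nat.dist]
  omega

/-- the cyclic distance is at most `m ∕ 2 ≤ m` [folklore] -/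
theorem cycd_le (m a b : ℕ) : cycd m a b ≤ m := by
  simp only [cycd]; omega

/-- `(a + b) ∕ c ≤ a ∕ c + b ∕ c + 1` in `ℕ` [folklore] -/
theorem add_div_le_succ (a b : ℕ) {c : ℕ} (hc : 0 < c) : (a + b) / c ≤ a / c + b / c + 1 := by
  rw [Nat.add_div hc]; split_ifs <;> omega

/-- division is subadditive up to one on differences: `⌊b∕L⌋ − ⌊a∕L⌋ ≤ ⌊(b−a)∕L⌋ + 1` for `a ≤ b` [folklore] -/
theorem div_sub_div_le {L a b : ℕ} (hL : 0 < L) (hab : a ≤ b) : b / L - a / L ≤ (b - a) / L + 1 := by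
  have h : b / L ≤ (b - a) / L + a / L + 1 :=
    calc b / L = (b - a + a) / L := by rw [Nat.sub_add_cancel hab]
      _ ≤ (b - a) / L + a / L + 1 := add_div_le_succ _ _ hL
  exact tsub_le_iff_right.2 (h.trans_eq (by ring))

/-- and superadditive: `⌊(b−a)∕L⌋ ≤ ⌊b∕L⌋ − ⌊a∕L⌋` for `a ≤ b` [folklore] -/
theorem sub_div_le_div_sub {L a b : ℕ} (hab : a ≤ b) : (b - a) / L ≤ b / L - a / L := by
  have h : (b - a) / L + a / L ≤ b / L :=
    calc (b - a) / L + a / L ≤ (b - a + a) / L := Nat.add_div_le_add_div _ _ _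
      _ = b / L := by rw [Nat.sub_add_cancel hab]
  exact Nat.le_sub_of_add_le h

/-- the blocked plain distance against the plain distance (upper) [folklore] -/
theorem dist_div_le {L : ℕ} (hL : 0 < L) (a b : ℕ) : Nat.dist (a / L) (b / L) ≤ Nat.dist a b / L + 1 := by
  rcases le_total a b with hab | hab
  · rw [Nat.dist_eq_sub_of_le (Nat.div_le_div_right hab), Nat.dist_eq_sub_of_le hab]
    exact div_sub_div_le hL hab
  · rw [Nat.dist_eq_sub_of_le_right (Nat.div_le_div_right hab), Nat.dist_eq_sub_of_le_right hab]
    exact div_sub_div_le hL hab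

/-- … (lower) [folklore] -/
theorem dist_div_ge (L a b : ℕ) : Nat.dist a b / L ≤ Nat.dist (a / L) (b / L) := by
  rcases le_total a b with hab | hab
  · rw [Nat.dist_eq_sub_of_le (Nat.div_le_div_right hab), Nat.dist_eq_sub_of_le hab]
    exact sub_div_le_div_sub hab
  · rw [Nat.dist_eq_sub_of_le_right (Nat.div_le_div_right hab), Nat.dist_eq_sub_of_le_right hab]
    exact sub_div_le_div_sub hab

/-- **BLOCKING CONTRACTS THE CYCLIC DISTANCE**: `cycd m ⌊a∕L⌋ ⌊b∕L⌋ ≤ cycd (m·L) a b ∕ L + 1` (natural division,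
`L ≥ 1`). [folklore] -/
theorem cycd_div_le {L : ℕ} (hL : 1 ≤ L) (m a b : ℕ) :
    cycd m (a / L) (b / L) ≤ cycd (m * L) a b / L + 1 := by
  have hL0 : 0 < L := hL
  have hup := dist_div_le hL0 a b
  have hlow := dist_div_ge L a b
  -- the wrapped branch: `m − dist' ≤ (mL − dist)/L + 1`
  have hwrap : m - Nat.dist (a / L) (b / L) ≤ (m * L - Nat.dist a b) / L + 1 := by
    have h1 : m - Nat.dist (a / L) (b / L) ≤ m - Nat.dist a b / L := Nat.sub_le_sub_left hlow m
    have h2 : m - Nat.dist a b / L ≤ (m * L - Nat.dist a b) / L + 1 := by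
      rcases le_total (Nat.dist a b) (m * L) with hp | hp
      · have h : m ≤ (m * L - Nat.dist a b) / L + Nat.dist a b / L + 1 :=
          calc m = m * L / L := (Nat.mul_div_cancel _ hL0).symm
            _ = (m * L - Nat.dist a b + Nat.dist a b) / L := by rw [Nat.sub_add_cancel hp]
            _ ≤ (m * L - Nat.dist a b) / L + Nat.dist a b / L + 1 := add_div_le_succ _ _ hL0
        exact tsub_le_iff_right.2 (h.trans_eq (by ring))
      · have h : m ≤ Nat.dist a b / L :=
          calc m = m * L / L := (Nat.mul_div_cancel _ hL0).symm
            _ ≤ Nat.dist a b / L := Nat.div_le_div_right hp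
        rw [Nat.sub_eq_zero_of_le h]; exact Nat.zero_le _
    exact h1.trans h2
  -- assemble: `min x' y' ≤ min x y / L + 1`
  unfold cycd
  rcases min_cases (Nat.dist a b) (m * L - Nat.dist a b) with ⟨h, _⟩ | ⟨h, _⟩
  · rw [h]; exact (min_le_left _ _).trans hup
  · rw [h]; exact (min_le_right _ _).trans hwrap

/-! ## §2 Block vectors: the cyclic sup-distance and the diameter of a zone -/

variable {d : ℕ}

/-- CYCLIC SUP-DISTANCE of two block vectors on `(ℤ∕m)^d` [folklore] -/
def cdist (m : ℕ) (u v : Fin d → ℕ) : ℕ := univ.sup fun i => cycd m (u i) (v i)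

/-- coordinatewise bound ⇒ `cdist` bound [folklore] -/
theorem cdist_le_iff {m : ℕ} {u v : Fin d → ℕ} {r : ℕ} : cdist m u v ≤ r ↔ ∀ i, cycd m (u i) (v i) ≤ r := by
  simp [cdist, Finset.sup_le_iff]

/-- `cdist` is symmetric [folklore] -/
theorem cdist_comm (m : ℕ) (u v : Fin d → ℕ) : cdist m u v = cdist m v u := by
  simp [cdist, cycd_comm]

/-- triangle inequality for `cdist` on vectors with coordinates `< m` [folklore] -/
theorem cdist_triangle {m : ℕ} {u v w : Fin d → ℕ} (hu : ∀ i, u i < m) (hv : ∀ i, v i < m) (hw : ∀ i, w i < m) :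
    cdist m u w ≤ cdist m u v + cdist m v w := by
  rw [cdist_le_iff]
  intro i
  calc cycd m (u i) (w i) ≤ cycd m (u i) (v i) + cycd m (v i) (w i) := cycd_triangle (hu i) (hv i) (hw i)
    _ ≤ cdist m u v + cdist m v w :=
        add_le_add (Finset.le_sup (f := fun i => cycd m (u i) (v i)) (mem_univ i))
          (Finset.le_sup (f := fun i => cycd m (v i) (w i)) (mem_univ i))

/-- THE DIAMETER of a zone (a finite set of block vectors): the largest pairwise cyclic sup-distance (`0` if empty).
[folklore] -/
def diam (m : ℕ) (S : Finset (Fin d → ℕ)) : ℕ := S.sup fun u => S.sup fun v => cdist m u v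

/-- pairs are within the diameter [folklore] -/
theorem cdist_le_diam {m : ℕ} {S : Finset (Fin d → ℕ)} {u v : Fin d → ℕ} (hu : u ∈ S) (hv : v ∈ S) :
    cdist m u v ≤ diam m S :=
  le_trans (Finset.le_sup (f := fun v => cdist m u v) hv) (Finset.le_sup (f := fun u => S.sup fun v => cdist m u v) hu)

/-- a bound on all pairs bounds the diameter [folklore] -/
theorem diam_le_iff {m : ℕ} {S : Finset (Fin d → ℕ)} {r : ℕ} : diam m S ≤ r ↔ ∀ u ∈ S, ∀ v ∈ S, cdist m u v ≤ r := by
  simp [diam, Finset.sup_le_iff]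

/-- A zone is IN RANGE `m` when all its block coordinates are `< m`. [folklore] -/
def InRange (m : ℕ) (S : Finset (Fin d → ℕ)) : Prop := ∀ u ∈ S, ∀ i, u i < m

/-! ## §3 Overlap: nearness of members and the merged diameter -/

/-- **(N) MEMBERS OF OVERLAPPING ZONES ARE NEAR**: if `A` and `B` share a block vector then for `a ∈ A`, `b ∈ B`,
`cdist m a b ≤ diam m A + diam m B` (the `AdmZ` radius `ext X + ext Y`, no gap term). [folklore] -/
theorem cdist_le_diam_add_of_overlap {m : ℕ} {A B : Finset (Fin d → ℕ)} (hA : InRange m A) (hB : InRange m B)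
    {z : Fin d → ℕ} (hzA : z ∈ A) (hzB : z ∈ B) {a b : Fin d → ℕ} (ha : a ∈ A) (hb : b ∈ B) :
    cdist m a b ≤ diam m A + diam m B :=
  (cdist_triangle (hA a ha) (hA z hzA) (hB b hb)).trans (add_le_add (cdist_le_diam ha hzA) (cdist_le_diam hzB hb))

/-- **(M) THE MERGED ZONE**: if `A` and `B` share a block vector then `diam m (A ∪ B) ≤ diam m A + diam m B`
(`ZoneDyn.merge` with the `+1` to spare). [folklore] -/
theorem diam_union_le_of_overlap {m : ℕ} {A B : Finset (Fin d → ℕ)} (hA : InRange m A) (hB : InRange m B)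
    {z : Fin d → ℕ} (hzA : z ∈ A) (hzB : z ∈ B) : diam m (A ∪ B) ≤ diam m A + diam m B := by
  rw [diam_le_iff]
  intro u hu v hv
  rw [mem_union] at hu hv
  rcases hu with hu | hu <;> rcases hv with hv | hv
  · exact (cdist_le_diam hu hv).trans (Nat.le_add_right _ _)
  · exact cdist_le_diam_add_of_overlap hA hB hzA hzB hu hv
  · rw [cdist_comm]; exact cdist_le_diam_add_of_overlap hA hB hzA hzB hv hu
  · exact (cdist_le_diam hu hv).trans (Nat.le_add_left _ _)

/-! ## §4 Blocking contracts the diameter -/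

/-- blocking of a block vector: `u ↦ (⌊u_i∕L⌋)_i` [folklore] -/
def blockVec (L : ℕ) (u : Fin d → ℕ) : Fin d → ℕ := fun i => u i / L

/-- the blocked zone [folklore] -/
def blocks (L : ℕ) (S : Finset (Fin d → ℕ)) : Finset (Fin d → ℕ) := S.image (blockVec L)

/-- blocking keeps the range: coordinates `< m·L` block to coordinates `< m` [folklore] -/
theorem inRange_blocks {L : ℕ} (hL : 1 ≤ L) {m : ℕ} {S : Finset (Fin d → ℕ)} (hS : InRange (m * L) S) :
    InRange m (blocks L S) := by
  intro u hu i
  obtain ⟨v, hv, rfl⟩ := mem_image.1 hu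
  exact (Nat.div_lt_iff_lt_mul hL).2 (hS v hv i)

/-- blocking contracts the sup-distance: `cdist m (blockVec L u) (blockVec L v) ≤ cdist (mL) u v ∕ L + 1` [folklore] -/
theorem cdist_blockVec_le {L : ℕ} (hL : 1 ≤ L) (m : ℕ) (u v : Fin d → ℕ) :
    cdist m (blockVec L u) (blockVec L v) ≤ cdist (m * L) u v / L + 1 := by
  rw [cdist_le_iff]
  intro i
  calc cycd m (u i / L) (v i / L) ≤ cycd (m * L) (u i) (v i) / L + 1 := cycd_div_le hL m (u i) (v i)
    _ ≤ cdist (m * L) u v / L + 1 :=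
        Nat.add_le_add_right (Nat.div_le_div_right
          (Finset.le_sup (f := fun i => cycd (m * L) (u i) (v i)) (mem_univ i))) 1

/-- **(S) BLOCKING CONTRACTS THE DIAMETER**: `diam m (blocks L S) ≤ diam (m·L) S ∕ L + 1` (natural division;
`ZoneDyn.step` with `σ² = 1∕L`). [folklore] -/
theorem diam_blocks_le {L : ℕ} (hL : 1 ≤ L) (m : ℕ) (S : Finset (Fin d → ℕ)) :
    diam m (blocks L S) ≤ diam (m * L) S / L + 1 := by
  rw [diam_le_iff]
  intro u hu v hv
  obtain ⟨u₀, hu₀, rfl⟩ := mem_image.1 hu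
  obtain ⟨v₀, hv₀, rfl⟩ := mem_image.1 hv
  exact (cdist_blockVec_le hL m u₀ v₀).trans
    (Nat.add_le_add_right (Nat.div_le_div_right (cdist_le_diam hu₀ hv₀)) 1)

/-- … in the reals: `diam m (blocks L S) ≤ (1∕L)·diam (mL) S + 1`. [folklore] -/
theorem diam_blocks_le_real {L : ℕ} (hL : 1 ≤ L) (m : ℕ) (S : Finset (Fin d → ℕ)) :
    (diam m (blocks L S) : ℝ) ≤ (1 / (L : ℝ)) * (diam (m * L) S : ℝ) + 1 := by
  have h := diam_blocks_le hL m S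
  have hL' : (0 : ℝ) < L := by exact_mod_cast hL
  have hdiv : ((diam (m * L) S / L : ℕ) : ℝ) ≤ (diam (m * L) S : ℝ) / (L : ℝ) := Nat.cast_div_le
  calc (diam m (blocks L S) : ℝ) ≤ ((diam (m * L) S / L : ℕ) : ℝ) + 1 := by exact_mod_cast h
    _ ≤ (diam (m * L) S : ℝ) / (L : ℝ) + 1 := by linarith
    _ = (1 / (L : ℝ)) * (diam (m * L) S : ℝ) + 1 := by ring

/-! ## §5 On the cutoff-`K` torus: overlapping zones make root cells `nearT` -/

/-- **OVERLAPPING ZONES ⇒ `nearT`.**  On the torus `TCell d (n·L^K)`: if `x` is a cell of scale `sx`, `y` of scale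
`sy`, `t ≤ K`, and their level-`t` block vectors lie in zones `A ∋ blk x`, `B ∋ blk y` (in range `n·L^{K−t}`) that
SHARE a block, then `nearT n L K x sx y sy t (diam A + diam B)`. [folklore] -/
theorem nearT_of_mem_overlap (n L K : ℕ) {x y : TCell d (n * L ^ K)} {sx sy t : ℕ} (ht : t ≤ K)
    (hx : IsScale L sx x) (hy : IsScale L sy y) {A B : Finset (Fin d → ℕ)}
    (hA : InRange (n * L ^ (K - t)) A) (hB : InRange (n * L ^ (K - t)) B)
    (hxA : (fun i => (x i).val / L ^ t) ∈ A) (hyB : (fun i => (y i).val / L ^ t) ∈ B)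
    {z : Fin d → ℕ} (hzA : z ∈ A) (hzB : z ∈ B) :
    nearT n L K x sx y sy t ((diam (n * L ^ (K - t)) A : ℝ) + diam (n * L ^ (K - t)) B) := by
  refine ⟨ht, hx, hy, fun i => ?_⟩
  have h := cdist_le_diam_add_of_overlap hA hB hzA hzB hxA hyB
  rw [cdist_le_iff] at h
  exact_mod_cast h i

/-! ## §6 Sanity (decided instances) -/

namespace Sanity

/-- on `ℤ∕7`: `cycd 7 1 6 = 2` (wraps), and the triangle `1 → 3 → 6`: `2 ≤ 2 + 3` -/
theorem triangle_seven : cycd 7 1 6 = 2 ∧ cycd 7 1 6 ≤ cycd 7 1 3 + cycd 7 3 6 := by decide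

/-- blocking by `L = 3` from `ℤ∕12` to `ℤ∕4`: the points `2, 9` at cyclic distance `5` block to `0, 3` at cyclic
distance `1 ≤ 5∕3 + 1` -/
theorem blocking_example : cycd 4 (2 / 3) (9 / 3) = 1 ∧ cycd 12 2 9 = 5 := by decide

/-- the diameter of the zone `{(0,1), (2,3)}` on `(ℤ∕5)²` is `2` -/
theorem diam_example : diam 5 ({![0, 1], ![2, 3]} : Finset (Fin 2 → ℕ)) = 2 := by decide

end Sanity

end Summit.QuantumFields.BalabanUV.T4Continuum.ZoneTorus
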